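import Summits.KontsevichZagierPeriods.KontsevichZagierPeriods.Theorems.MzvKernelInKZTwoPosetsFurushoConverse
import Summits.KontsevichZagierPeriods.KontsevichZagierPeriods.Theorems.MzvKernelInKZTwoPosetsShuffleProduct

/-!
# `ShuffleIsDissection` (stmt-KontsevichZagierPeriods-3932, route `FurushoPentagon`) — PROVED

The support item `ShuffleIsDissection` of route `FurushoPentagon`: for every assignment `Z` pinned
to the classes of Kontsevich's simplex representations `KZ.mzvRep` on admissible indices and all
admissible `s`, `t`, the shuffle defect
`Z s · Z t − Σ_{w ∈ ε(s) ш ε(t)} Z (index of w)` (`MZV.shuffleWord`, `MZV.binaryWord`,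
`MZV.ofBinaryWord`, with multiplicity) lies in `KZ.relations` — the product of two simplices
`Δ_s × Δ_t` is, off the null tie walls `{xᵢ = yⱼ}`, the disjoint union of the shuffle cells, each a
coordinate permutation of the standard simplex carrying the interleaved word integrand
(Kontsevich–Zagier 2001, §1.2; Eie 2013, §1.2): rules (1a) (domain additivity) and (2)
(change of variables) only. This is the group-likeness of the rules associator `Φ_P` (X2 of the
route's thesis).

The proof is the composition of two theorems of the sibling crux `LinRedNormalForm.MzvKernelInKZ`
(line two-posets-interior-landen), both in the tree:

* the geometry `MzvKernelInKZ.TwoPosets.stub_shuffleProduct : ShuffleProductInKZ`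
  (`Theorems/MzvKernelInKZTwoPosetsShuffleProduct.lean`): for admissible words of positive lengths
  the product of the canonical word representations `[Δ_a, ω_ε] · [Δ_b, ω_ε']` minus the sum of the
  word representations of the interleavings is a relation — the shuffle cells (one per coordinate
  shuffle) dissect `Δ_a × Δ_b` up to the null tie walls (`KZ.of_sub_sum_of_mem_relations`,
  rule (1a)) and each cell is the reindexing of a word simplex along its sorting permutation
  (`KZ.of_sub_of_reindex_mem_relations`, rule (2));
* the bookkeeping `MzvKernelInKZ.TwoPosets.stub_shuffleIsDissectionOfLine :
  ShuffleProductInKZ → ShuffleIsDissection` (`Theorems/MzvKernelInKZTwoPosetsFurushoConverse.lean`):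
  the canonical word representation of an admissible index IS `KZ.mzvRep`
  (`wordRep_bword_eq_mzvRep`), every interleaving reads back as an admissible index
  (`zIdx_ofBinaryWord_of_mem_shuffleWord`), and the degenerate instances `s = []` / `t = []`
  (`[] ш v = [v]`, `KZ.mzvRep [] = [pt, 1]`) are the unit law of the Fubini product modulo
  relations (`KZ.of_unit_mul_sub_mem_relations`, one reindexing move).

Sources: M. Kontsevich, D. Zagier, *Periods* (2001), §1.2, §4.1; M. Eie, *The Theory of Multiple
Zeta Values with Applications in Combinatorics* (2013), §1.2; K. Ihara, M. Kaneko, D. Zagier,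
Compos. Math. 142 (2006), §1 (finite double shuffle).
-/

noncomputable section

namespace Summit.KontsevichZagierPeriods.FurushoPentagon.ShuffleIsDissection

open Summit.KontsevichZagierPeriods.MzvKernelInKZ.TwoPosets
open Summit.KontsevichZagierPeriods.KontsevichZagierPeriods.Theses.FurushoPentagon
  (ShuffleIsDissection)

/-- **`ShuffleIsDissection` (stmt-KontsevichZagierPeriods-3932) holds**: for every assignment `Z`
pinned to Kontsevich's simplex classes on admissible indices and all admissible `s`, `t`,
`Z s · Z t − Σ_{w ∈ ε(s) ш ε(t)} Z (index of w) ∈ KZ.relations`. Non-empty indices: the shuffle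
cells dissect `Δ_s × Δ_t` off the null tie walls (rule (1a)) and each cell is a coordinate
permutation of a word simplex (rule (2)) — `TwoPosets.stub_shuffleProduct`, transported to
`KZ.mzvRep` by `TwoPosets.stub_shuffleIsDissectionOfLine`; `s = []` or `t = []`: `[] ш v = [v]`,
`Z [] = [pt, 1]` and the unit law of the Fubini product modulo relations.
[cite: KontsevichZagier2001, §1.2] -/
theorem shuffleIsDissection_proof : ShuffleIsDissection :=
  stub_shuffleIsDissectionOfLine stub_shuffleProduct

end Summit.KontsevichZagierPeriods.FurushoPentagon.ShuffleIsDissection
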